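import Summits.CriticalPhenomena.PercolationContinuityZ3.Theorems.PercNearOneGluingNoHeavyQuantTwoBig
import HarnessLib

/-!
# QUANT lane R8, Conjecture DIB\* — the two-big certificate, part 1: monotone reductions and closed-form items

builds on p205010 (kernel theorem, internal audit signed; external expert review pending)

Support file (`--supports stmt-CriticalPhenomena-4575`), QUANT lane census-1 (gen 17); memo
`run/shared/lean/prim/quant/prim-quant-census-1/TWOBIG-G17.md`.  Theorems only, no definitions, no sorries, standard axioms.

THE OBJECT.  The B/S two-big certificate (lead g19 `TwoBigCertAt`, `…QuantTwoBig`; p1 g13's variant with a cloud of blobs of size `≤ j`,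
`V ≤ j·s2`): `x ≤ p₁p₂ + p₁q₂·z₁ + q₁p₂·z₂ + q₁q₂·z₀` with menu items at the levels `ℓ₁ = j − b₁`, `ℓ₂ = j − b₂`, `j`.  This file
bounds the menu items from below by CLOSED FORMS in the coordinates `x`, `c̃ = 2 − u₁ − u₂` (`uᵢ = bᵢφᵢ/j`), `λ = ℓ/j`, `w = c̃ − λ`
(`V ≤ j(1−x)(2m − c⋆)`, `c⋆ = 2j − b₁φ₁ − b₂φ₂`), by three monotone reductions with exact factorisations (as in `…QuantOneBigCert` /
`…QuantOneBigCertificates` for one big):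
* `tbc_cantelli_closed`: Cantelli at level `L = jλ`: `w²/((1−x)c̃ + w²) ≤ 1 − V/(V + (m − L)²)`;
* `tbc_markov_closed`: Markov on the closed mass at level `L`, in the region `c̃ ≤ (1+x)λ`: `x·w/(c̃ − xλ) ≤ 1 − (A − m)/(A − L)`;
* `tbc_block_le`: the separable-certificate bookkeeping `c·D ≤ B·N`, `N ≤ t·D` ⟹ `c ≤ B·t`.
[this work]; the gluing rows served [cite: KozmaNitzan2024, Conjecture 3 (p. 15)]; product weights [cite: Grimmett1999, §1.3 p. 10].
-/

namespace Summit.CriticalPhenomena.PercolationContinuityZ3.Theorems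

namespace Quant

namespace IndepBlob

/-! ### 1. Monotone reductions -/

/-- Cantelli item, monotone in the variance: `0 ≤ V ≤ W`, `0 < d2` ⟹ `d2/(W + d2) ≤ 1 − V/(V + d2)`. [this work] -/
theorem tbc_cantelli_V (V W d2 : ℝ) (hV : 0 ≤ V) (hVW : V ≤ W) (hd : 0 < d2) :
    d2 / (W + d2) ≤ 1 - V / (V + d2) := by
  have hVd : 0 < V + d2 := by linarith
  rw [one_sub_div hVd.ne', add_sub_cancel_left]
  exact div_le_div_of_nonneg_left hd.le hVd (by linarith)

/-- Cantelli item with the linear variance bound `k(2m − c⋆)`, monotone in the mean: for `0 < k`, `0 < c⋆`, `0 ≤ L ≤ c⋆ ≤ m`: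
`(c⋆ − L)²/(k c⋆ + (c⋆ − L)²) ≤ (m − L)²/(k(2m − c⋆) + (m − L)²)`
(`c⋆(m−L)² − (2m−c⋆)(c⋆−L)² = (m − c⋆)(c⋆(m − c⋆) + 2L(c⋆ − L))`). [this work] -/
theorem tbc_cantelli_mono (k L cs m : ℝ) (hk : 0 < k) (hcs : 0 < cs) (hL : 0 ≤ L) (hLcs : L ≤ cs) (hcm : cs ≤ m) :
    (cs - L) ^ 2 / (k * cs + (cs - L) ^ 2) ≤ (m - L) ^ 2 / (k * (2 * m - cs) + (m - L) ^ 2) := by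
  have h1 : 0 < k * cs + (cs - L) ^ 2 := by nlinarith [mul_pos hk hcs]
  have h2 : 0 < k * (2 * m - cs) + (m - L) ^ 2 := by nlinarith [mul_pos hk (by linarith : 0 < 2 * m - cs)]
  rw [div_le_div_iff₀ h1 h2]
  have e : (m - L) ^ 2 * (k * cs + (cs - L) ^ 2) - (cs - L) ^ 2 * (k * (2 * m - cs) + (m - L) ^ 2) =
      k * ((m - cs) * (cs * (m - cs) + 2 * L * (cs - L))) := by ring
  have h : 0 ≤ k * ((m - cs) * (cs * (m - cs) + 2 * L * (cs - L))) :=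
    mul_nonneg hk.le (mul_nonneg (by linarith) (by nlinarith))
  linarith

/-- Markov item, monotone in the total: `0 ≤ m − L`, `0 < A − L`, `A ≤ A⁺` ⟹ `(m − L)/(A⁺ − L) ≤ 1 − (A − m)/(A − L)`. [this work] -/
theorem tbc_markov_A (m A Ap L : ℝ) (hmL : 0 ≤ m - L) (hAL : 0 < A - L) (hAAp : A ≤ Ap) :
    (m - L) / (Ap - L) ≤ 1 - (A - m) / (A - L) := by
  rw [one_sub_div hAL.ne', show A - L - (A - m) = m - L by ring]
  exact div_le_div_of_nonneg_left hmL hAL (by linarith)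

/-- Markov item, monotone in the mean when `e ≤ L`: `e < c⋆ ≤ m` ⟹ `(c⋆ − L)/(c⋆ − e) ≤ (m − L)/(m − e)`. [this work] -/
theorem tbc_markov_mono (e L cs m : ℝ) (heL : e ≤ L) (hecs : e < cs) (hcm : cs ≤ m) :
    (cs - L) / (cs - e) ≤ (m - L) / (m - e) := by
  rw [div_le_div_iff₀ (by linarith) (by linarith)]
  nlinarith [mul_nonneg (sub_nonneg.2 heL) (sub_nonneg.2 hcm)]

/-! ### 2. Closed forms (`V ≤ J(1−x)(2m − c⋆)`, `c⋆ = J c̃`, `L = J λ`, `c⋆ − L = J w`) -/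

/-- Positivity of the Cantelli denominator `(1−x)c̃ + w²` (`x < 1`, `c̃ > 0`). [this work] -/
theorem tbc_D_pos (x ct w : ℝ) (hx1 : x < 1) (hct : 0 < ct) : 0 < (1 - x) * ct + w ^ 2 := by
  nlinarith [mul_pos (sub_pos.2 hx1) hct, sq_nonneg w]

/-- **Cantelli at level `L`, closed form**: `w²/((1−x)c̃ + w²) ≤ 1 − V/(V + (m − L)²)`. [this work] -/
theorem tbc_cantelli_closed (x ct w V J L cs m : ℝ) (hJ : 0 < J) (hx1 : x < 1) (hcs : cs = J * ct) (hw : cs - L = J * w)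
    (hct : 0 < ct) (hV : 0 ≤ V) (hVle : V ≤ J * (1 - x) * (2 * m - cs)) (hL : 0 ≤ L) (hLcs : L ≤ cs) (hcm : cs ≤ m) (hLm : L < m) :
    w ^ 2 / ((1 - x) * ct + w ^ 2) ≤ 1 - V / (V + (m - L) ^ 2) := by
  have hk : 0 < J * (1 - x) := mul_pos hJ (by linarith)
  have hcs0 : 0 < cs := by rw [hcs]; exact mul_pos hJ hct
  have step1 := tbc_cantelli_mono (J * (1 - x)) L cs m hk hcs0 hL hLcs hcm
  have step2 := tbc_cantelli_V V (J * (1 - x) * (2 * m - cs)) ((m - L) ^ 2) hV hVle (by nlinarith)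
  have hD := tbc_D_pos x ct w hx1 hct
  have hD2 : 0 < J * (1 - x) * cs + (cs - L) ^ 2 := by nlinarith [mul_pos hk hcs0]
  have e : w ^ 2 / ((1 - x) * ct + w ^ 2) = (cs - L) ^ 2 / (J * (1 - x) * cs + (cs - L) ^ 2) := by
    rw [div_eq_div_iff hD.ne' hD2.ne', hw, hcs]
    ring
  rw [e]
  exact step1.trans step2

/-- **Markov at level `L` in the region `c̃ ≤ (1+x)λ`, closed form**: `x·w/(c̃ − xλ) ≤ 1 − (A − m)/(A − L)`. [this work] -/
theorem tbc_markov_closed (x ct lam w A J L cs m : ℝ) (hJ : 0 < J) (hx : 1 / 2 ≤ x) (hx1 : x < 1) (hcs : cs = J * ct)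
    (hLd : L = J * lam) (hw : cs - L = J * w) (hct : 0 < ct) (hwl : 0 ≤ w) (hreg : ct ≤ (1 + x) * lam)
    (hcm : cs ≤ m) (hA : x ^ 2 * A ≤ m - (1 - x) * cs) (hLA : L < A) :
    x * w / (ct - x * lam) ≤ 1 - (A - m) / (A - L) := by
  have hx0 : 0 < x := by linarith
  have hx2 : 0 < x ^ 2 := by positivity
  have hctlam : lam ≤ ct := by nlinarith
  have hden : 0 < ct - x * lam := by nlinarith
  set e := x ^ 2 * L + (1 - x) * cs with he
  have heL : e ≤ L := by
    have h1 : J * ((1 - x) * ct) ≤ J * ((1 - x) * ((1 + x) * lam)) :=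
      mul_le_mul_of_nonneg_left (mul_le_mul_of_nonneg_left hreg (by linarith)) hJ.le
    rw [he, hcs, hLd]; nlinarith [h1]
  have hecs : e < cs := by
    have h1 : 0 < J * (x * (ct - x * lam)) := mul_pos hJ (mul_pos hx0 hden)
    rw [he, hcs, hLd]; nlinarith [h1]
  have hmL : 0 ≤ m - L := by nlinarith
  have hAAp : A ≤ (m - (1 - x) * cs) / x ^ 2 := by rw [le_div_iff₀ hx2]; linarith
  have step1 := tbc_markov_A m A ((m - (1 - x) * cs) / x ^ 2) L hmL (by linarith) hAAp
  have step2 := tbc_markov_mono e L cs m heL hecs hcm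
  have e1 : (m - L) / ((m - (1 - x) * cs) / x ^ 2 - L) = x ^ 2 * ((m - L) / (m - e)) := by
    have hme : 0 < m - e := by linarith
    rw [he]
    field_simp
    ring
  have e2 : x * w / (ct - x * lam) = x ^ 2 * ((cs - L) / (cs - e)) := by
    have h2 : 0 < cs - e := by linarith
    rw [mul_div_assoc', div_eq_div_iff hden.ne' h2.ne', he, hw, hcs, hLd]
    ring
  rw [e2]
  rw [e1] at step1
  exact (mul_le_mul_of_nonneg_left step2 hx2.le).trans step1

/-! ### 3. Bookkeeping for separable certificates -/

/-- If `c·D ≤ B·N`, `N ≤ t·D`, `B ≥ 0`, `D > 0` then `c ≤ B·t`. [this work] -/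
theorem tbc_block_le (B N D c t : ℝ) (hB : 0 ≤ B) (hD : 0 < D) (ht : N ≤ t * D) (hc : c * D ≤ B * N) : c ≤ B * t := by
  have h2 : B * N ≤ B * (t * D) := mul_le_mul_of_nonneg_left ht hB
  have h3 : c * D ≤ (B * t) * D := by linarith
  exact le_of_mul_le_mul_right h3 hD

/-- From a closed-form bound `N/D ≤ z` with `D > 0` to the product form `N ≤ z·D`. [this work] -/
theorem tbc_item_prod (N D z : ℝ) (hD : 0 < D) (h : N / D ≤ z) : N ≤ z * D := by
  rwa [div_le_iff₀ hD] at h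

/-! ### 4. Per-big coordinates -/

/-- Per-big bookkeeping: from the natural data of one big (`J = j > 0`, `B = b` with `J < 2B`, `B ≤ J`, gate `p ∈ [x², 1]`, rate
`φ = φ_x(p)`) the coordinates `u = Bφ/J`, `v = (B − Bφ)/J` satisfy the generator inequalities, and `(u+v)·p`, the type inequality take
the heavy resp. light closed forms. [this work] -/
theorem tbc_big_coords (x p J B : ℝ) (hx : 1 / 2 ≤ x) (hx1 : x < 1) (hxp : x ^ 2 ≤ p) (hp1 : p ≤ 1) (hJ : 0 < J) (hJB : J < 2 * B)
    (hBJ : B ≤ J) :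
    let φ : ℝ := if x ≤ p then p else (p - x ^ 2) / (1 - x)
    0 ≤ φ ∧ φ ≤ 1 ∧ 0 ≤ B * φ / J ∧ 0 ≤ (B - B * φ) / J ∧ B * φ / J + (B - B * φ) / J ≤ 1 ∧
      1 / 2 ≤ B * φ / J + (B - B * φ) / J ∧
      (x ≤ p → (B * φ / J + (B - B * φ) / J) * p = B * φ / J ∧ 0 ≤ B * φ / J * (1 - x) - x * ((B - B * φ) / J)) ∧
      (¬ x ≤ p → (B * φ / J + (B - B * φ) / J) * p = (B * φ / J + (B - B * φ) / J) * x ^ 2 + (1 - x) * (B * φ / J) ∧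
        0 ≤ x * ((B - B * φ) / J) - B * φ / J * (1 - x) ∧ φ < 1) := by
  intro φ
  have hx0 : 0 < x := by linarith
  have hy0 : 0 < 1 - x := by linarith
  have hB : 0 < B := by linarith
  have hφp : φ ≤ p := phi_le_gate x p hx0.le hx1
  have hφ1 : φ ≤ 1 := hφp.trans hp1
  have hφ0 : 0 ≤ φ := by
    show 0 ≤ (if x ≤ p then p else (p - x ^ 2) / (1 - x))
    split_ifs with h
    · linarith
    · exact div_nonneg (by linarith) hy0.le
  have hBφ : B * φ ≤ B := mul_le_of_le_one_right hB.le hφ1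
  have hα : B * φ / J + (B - B * φ) / J = B / J := by rw [← add_div]; congr 1; ring
  refine ⟨hφ0, hφ1, div_nonneg (mul_nonneg hB.le hφ0) hJ.le, div_nonneg (by linarith) hJ.le, ?_, ?_, ?_, ?_⟩
  · rw [hα, div_le_one hJ]; exact hBJ
  · rw [hα, le_div_iff₀ hJ]; linarith
  · intro h
    have hφe : φ = p := by show (if x ≤ p then p else (p - x ^ 2) / (1 - x)) = p; rw [if_pos h]
    refine ⟨by rw [hα, hφe]; ring, ?_⟩
    rw [hφe, show B * p / J * (1 - x) = B / J * (p * (1 - x)) by ring, show x * ((B - B * p) / J) = B / J * (x * (1 - p)) by ring]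
    have : B / J * (x * (1 - p)) ≤ B / J * (p * (1 - x)) := mul_le_mul_of_nonneg_left (by nlinarith) (div_nonneg hB.le hJ.le)
    linarith
  · intro h
    have hpx : p < x := not_le.1 h
    have hφe : φ = (p - x ^ 2) / (1 - x) := by show (if x ≤ p then p else (p - x ^ 2) / (1 - x)) = _; rw [if_neg h]
    have hφy : (1 - x) * φ = p - x ^ 2 := by rw [hφe, mul_div_cancel₀ _ hy0.ne']
    have hφx : φ < x := by
      rw [hφe, div_lt_iff₀ hy0]
      have e : x * (1 - x) = x - x ^ 2 := by ring
      rw [e]; linarith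
    refine ⟨?_, ?_, hφx.trans hx1⟩
    · rw [hα, show (1 - x) * (B * φ / J) = B / J * ((1 - x) * φ) by ring, hφy]; ring
    · rw [show x * ((B - B * φ) / J) = B / J * (x * (1 - φ)) by ring, show B * φ / J * (1 - x) = B / J * (φ * (1 - x)) by ring]
      have : B / J * (φ * (1 - x)) ≤ B / J * (x * (1 - φ)) := mul_le_mul_of_nonneg_left (by nlinarith) (div_nonneg hB.le hJ.le)
      linarith

end IndepBlob

end Quant

end Summit.CriticalPhenomena.PercolationContinuityZ3.Theorems
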